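import Summits.QuantumFields.YangMills.Theorems.FradkinShenkerFlowStrongPinningPoincareHeatBathGap
import HarnessLib

/-!
# Robust ball (Y2) — WARM-START MIXING OF THE HEAT-BATH (GIBBS) SAMPLER FROM A VARIANCE CONTRACTION, uniformly in the volume

HONEST FRAMING: venture file of the cell `pub-ymgap` (QuantumFields programme), track ROBUST-BALL, seat rb-p2 (g13); companion of `HeatBathSweep.lean`
(`variance_sweep_le`: a heat-bath Poincaré inequality `Var_μ ≤ A ∑_i ∫∫ (F − F∘[i↦e])²` makes ONE random-scan single-site heat-bath step
`P f(x) = |ι|⁻¹ ∑_i ∫ f(x[i ↦ e]) dν_i^x(e)` contract the `L²(μ)`-variance by `θ = 1 − (2A|ι|)⁻¹`).  This file is the abstract measure-theoretic sequel,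
importing only the YangMills summit's heat-bath kernel algebra: from ANY one-step contraction `Var_μ(P F) ≤ θ Var_μ(F)` (bounded measurable `F`) it derives,
for the tilted product measure `μ = (lam^{⊗ι}).tilted V`,
* `variance_sweep_iterate_le_of_le` — `Var_μ(P^k f) ≤ θ^k Var_μ(f)`;
* `integral_sweep_iterate`, `integral_sweep_iterate_mul_comm` — `P^k` preserves the mean and is `μ`-symmetric: `∫ (P^k u) v dμ = ∫ u (P^k v) dμ`
  (so `∫ (P^k g) h dμ`, the expectation of the observable `g` after `k` random-scan heat-bath updates started from the law `h·μ` in the Chapman–Kolmogorov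
  reading, equals `∫ g · (P^k h) dμ`: the `k`-step law has density `P^k h`);
* ★★★ `abs_integral_sweep_iterate_mul_sub_le` — WARM-START MIXING OF OBSERVABLES: `|∫ (P^k g) h dμ − (∫ g dμ)(∫ h dμ)| ≤ (θ^k Var_μ(g) Var_μ(h))^{1/2}`;
* ★★★ `integral_abs_sweep_iterate_sub_one_le` — WARM-START `L¹` (total-variation) MIXING: for a bounded measurable `h` with `∫ h dμ = 1` (no sign
  condition is needed): `∫ |P^k h − 1| dμ ≤ (θ^k Var_μ(h))^{1/2} = θ^{k/2} ‖h − 1‖_{L²(μ)}`;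
* ★★ `abs_integral_sweep_iterate_indicator_mul_sub_le` — EVENTS: `|∫ (P^k 1_S) h dμ − μ(S)| ≤ ½ (θ^k Var_μ(h))^{1/2}` for every measurable `S`.
With the cell's heat-bath Poincaré inequalities (`HeatBathPoincare*`: `SU(2)`, `d = 4`, `0 ≤ β_W < 2/9`, `A = (2 − 9β_W)⁻¹`, so `θ^{|E|} ≤ e^{−(1 − 9β_W/2)}` per
sweep, uniformly in the volume) this reads: from an initial law with density `h ∈ L²(μ_{β,L})` the heat-bath algorithm is within `ε` of `μ_{β,L}` in total
variation after `2(1 − 9β_W/2)⁻¹ · log(‖h − 1‖₂/ε)` sweeps (e.g. `O(β_W |Λ| + log(1/ε))` sweeps from the `β = 0` product-Haar start, whose density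
`h = Z e^{−β S_W}`-type tilt has `log ‖h‖₂ = O(β_W |Λ|)`) — the cells are the companion `HeatBathSweepCells.lean`.  LATTICE ∕ algorithmic statements at STRONG COUPLING; no Markov chain object is
constructed (the statements are inequalities between integrals of the iterated operator); nothing about `β → ∞`, the continuum or Clay.
0 sorry, 0 definitions.  References: P. Diaconis, L. Saloff-Coste, Ann. Appl. Probab. 6 (1996) 695–750 (`L²` → total variation from a warm start);
M. Creutz, Phys. Rev. D 21 (1980) 2308; L. Wu, Ann. Probab. 34 (2006) 1960.  Everything here is proved. [folklore]
-/

noncomputable section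

open MeasureTheory Function Real Finset ProbabilityTheory
open Summit.QuantumFields.YangMills.Theorems.StrongPinningPoincare

namespace Summit.Ventures.YMGap.RobustBall.HeatBathSweep

section Abstract

variable {ι : Type*} [Fintype ι] [DecidableEq ι] {E : Type*} [MeasurableSpace E]
  (lam : Measure E) [IsProbabilityMeasure lam] {V : (ι → E) → ℝ}

/-- The iterates `P^k f` of a measurable `f` under the random-scan heat-bath operator are measurable. [folklore] -/
theorem measurable_sweep_iterate (hV : Measurable V) {f : (ι → E) → ℝ} (hf : Measurable f) (k : ℕ) :
    Measurable ((fun g : (ι → E) → ℝ => fun x => (Fintype.card ι : ℝ)⁻¹ *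
      ∑ i, ∫ e, g (update x i e) ∂(lam.tilted fun e => V (update x i e)))^[k] f) := by
  induction k with
  | zero => exact hf
  | succ k ih => rw [Function.iterate_succ_apply']; exact HeatBath.measurable_randomScan lam hV ih

/-- The iterates `P^k f` keep the sup bound of `f`: `|f| ≤ M ⇒ |P^k f| ≤ M`. [folklore] -/
theorem abs_sweep_iterate_le [Nonempty ι] (hV : Measurable V) {Bv : ℝ} (hB : ∀ x, |V x| ≤ Bv) {f : (ι → E) → ℝ} {M : ℝ}
    (hM : ∀ x, |f x| ≤ M) (k : ℕ) (x : ι → E) :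
    |((fun g : (ι → E) → ℝ => fun x => (Fintype.card ι : ℝ)⁻¹ *
      ∑ i, ∫ e, g (update x i e) ∂(lam.tilted fun e => V (update x i e)))^[k] f) x| ≤ M := by
  induction k generalizing x with
  | zero => exact hM x
  | succ k ih => rw [Function.iterate_succ_apply']; exact HeatBath.abs_randomScan_le lam hV hB ih x

/-- `P^k` preserves the mean (DLR): `∫ P^k f dμ = ∫ f dμ`. [folklore] -/
theorem integral_sweep_iterate [Nonempty ι] (hV : Measurable V) {Bv : ℝ} (hB : ∀ x, |V x| ≤ Bv) {f : (ι → E) → ℝ} (hf : Measurable f)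
    {M : ℝ} (hM : ∀ x, |f x| ≤ M) (k : ℕ) :
    ∫ x, ((fun g : (ι → E) → ℝ => fun x => (Fintype.card ι : ℝ)⁻¹ *
        ∑ i, ∫ e, g (update x i e) ∂(lam.tilted fun e => V (update x i e)))^[k] f) x ∂((Measure.pi fun _ : ι => lam).tilted V) =
      ∫ x, f x ∂((Measure.pi fun _ : ι => lam).tilted V) := by
  induction k with
  | zero => rfl
  | succ k ih =>
    have hkm := measurable_sweep_iterate lam hV hf k
    have hkb := abs_sweep_iterate_le lam hV hB hM k
    rw [← ih]
    simp only [Function.iterate_succ_apply']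
    exact HeatBath.integral_randomScan lam hV hB hkm hkb

/-- `P^k` is `μ`-symmetric on bounded measurable functions: `∫ (P^k u) v dμ = ∫ u (P^k v) dμ` — in the Chapman–Kolmogorov reading, the expectation of `v` after
`k` random-scan heat-bath updates from the initial law `u·μ` equals `∫ v · P^k u dμ`: the `k`-step law has density `P^k u` with respect to `μ`. [folklore] -/
theorem integral_sweep_iterate_mul_comm [Nonempty ι] (hV : Measurable V) {Bv : ℝ} (hB : ∀ x, |V x| ≤ Bv) (k : ℕ) {u v : (ι → E) → ℝ}
    (hu : Measurable u) (hv : Measurable v) {Mu Mv : ℝ} (hMu : ∀ x, |u x| ≤ Mu) (hMv : ∀ x, |v x| ≤ Mv) :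
    ∫ x, ((fun g : (ι → E) → ℝ => fun x => (Fintype.card ι : ℝ)⁻¹ *
        ∑ i, ∫ e, g (update x i e) ∂(lam.tilted fun e => V (update x i e)))^[k] u) x * v x ∂((Measure.pi fun _ : ι => lam).tilted V) =
      ∫ x, u x * ((fun g : (ι → E) → ℝ => fun x => (Fintype.card ι : ℝ)⁻¹ *
        ∑ i, ∫ e, g (update x i e) ∂(lam.tilted fun e => V (update x i e)))^[k] v) x ∂((Measure.pi fun _ : ι => lam).tilted V) := by
  induction k generalizing u v Mu Mv with
  | zero => rfl
  | succ k ih =>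
    have hkm := measurable_sweep_iterate lam hV hu k
    have hkb := abs_sweep_iterate_le lam hV hB hMu k
    have hTv : Measurable fun x => (Fintype.card ι : ℝ)⁻¹ * ∑ i, ∫ e, v (update x i e) ∂(lam.tilted fun e => V (update x i e)) :=
      HeatBath.measurable_randomScan lam hV hv
    have hTvb : ∀ x, |(Fintype.card ι : ℝ)⁻¹ * ∑ i, ∫ e, v (update x i e) ∂(lam.tilted fun e => V (update x i e))| ≤ Mv :=
      fun x => HeatBath.abs_randomScan_le lam hV hB hMv x
    have h1 := HeatBath.integral_randomScan_mul_comm lam hV hB hkm hv hkb hMv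
    have h2 := ih hu hTv hMu hTvb
    refine Eq.trans ?_ h2
    refine Eq.trans ?_ h1
    simp only [Function.iterate_succ_apply']

/-- **Iterated variance contraction**: if one random-scan heat-bath step contracts the variance of every bounded measurable `F` by `θ ≥ 0`
(`Var_μ(P F) ≤ θ Var_μ(F)` — e.g. `θ = 1 − (2A|ι|)⁻¹` from a heat-bath Poincaré inequality, `HeatBathSweep.variance_sweep_le`), then
`Var_μ(P^k f) ≤ θ^k Var_μ(f)`. [folklore] -/
theorem variance_sweep_iterate_le_of_le [Nonempty ι] (hV : Measurable V) {Bv : ℝ} (hB : ∀ x, |V x| ≤ Bv) {θ : ℝ} (hθ : 0 ≤ θ)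
    (hcon : ∀ (F : (ι → E) → ℝ), Measurable F → (∃ M : ℝ, ∀ x, |F x| ≤ M) →
      variance (fun x => (Fintype.card ι : ℝ)⁻¹ * ∑ i, ∫ e, F (update x i e) ∂(lam.tilted fun e => V (update x i e)))
        ((Measure.pi fun _ : ι => lam).tilted V) ≤ θ * variance F ((Measure.pi fun _ : ι => lam).tilted V))
    {f : (ι → E) → ℝ} (hf : Measurable f) {M : ℝ} (hM : ∀ x, |f x| ≤ M) (k : ℕ) :
    variance ((fun g : (ι → E) → ℝ => fun x => (Fintype.card ι : ℝ)⁻¹ *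
        ∑ i, ∫ e, g (update x i e) ∂(lam.tilted fun e => V (update x i e)))^[k] f) ((Measure.pi fun _ : ι => lam).tilted V) ≤
      θ ^ k * variance f ((Measure.pi fun _ : ι => lam).tilted V) := by
  induction k with
  | zero => simp
  | succ k ih =>
    have hkm := measurable_sweep_iterate lam hV hf k
    have hkb := abs_sweep_iterate_le lam hV hB hM k
    rw [Function.iterate_succ_apply', pow_succ, mul_comm (θ ^ k), mul_assoc]
    exact (hcon _ hkm ⟨M, hkb⟩).trans (mul_le_mul_of_nonneg_left ih hθ)

/-- ★★★ **WARM-START MIXING OF OBSERVABLES**: under a one-step variance contraction `Var_μ(P F) ≤ θ Var_μ(F)`, for bounded measurable `g`, `h`,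
`|∫ (P^k g) h dμ − (∫ g dμ)(∫ h dμ)| ≤ (θ^k · Var_μ(g) · Var_μ(h))^{1/2}` — with `h` a probability density (`∫ h dμ = 1`), `∫ (P^k g) h dμ` is the expectation of
`g` after `k` random-scan heat-bath updates from the initial law `h·μ`, and it is within `θ^{k/2} σ_μ(g) ‖h − 1‖_{L²(μ)}` of the equilibrium mean `∫ g dμ`.
[folklore] -/
theorem abs_integral_sweep_iterate_mul_sub_le [Nonempty ι] (hV : Measurable V) {Bv : ℝ} (hB : ∀ x, |V x| ≤ Bv) {θ : ℝ} (hθ : 0 ≤ θ)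
    (hcon : ∀ (F : (ι → E) → ℝ), Measurable F → (∃ M : ℝ, ∀ x, |F x| ≤ M) →
      variance (fun x => (Fintype.card ι : ℝ)⁻¹ * ∑ i, ∫ e, F (update x i e) ∂(lam.tilted fun e => V (update x i e)))
        ((Measure.pi fun _ : ι => lam).tilted V) ≤ θ * variance F ((Measure.pi fun _ : ι => lam).tilted V))
    (k : ℕ) {g h : (ι → E) → ℝ} (hg : Measurable g) (hh : Measurable h) {Mg Mh : ℝ} (hMg : ∀ x, |g x| ≤ Mg) (hMh : ∀ x, |h x| ≤ Mh) :
    |∫ x, ((fun g : (ι → E) → ℝ => fun x => (Fintype.card ι : ℝ)⁻¹ *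
          ∑ i, ∫ e, g (update x i e) ∂(lam.tilted fun e => V (update x i e)))^[k] g) x * h x ∂((Measure.pi fun _ : ι => lam).tilted V) -
        (∫ x, g x ∂((Measure.pi fun _ : ι => lam).tilted V)) * ∫ x, h x ∂((Measure.pi fun _ : ι => lam).tilted V)| ≤
      Real.sqrt (θ ^ k * variance g ((Measure.pi fun _ : ι => lam).tilted V) * variance h ((Measure.pi fun _ : ι => lam).tilted V)) := by
  haveI := HeatBath.isProbabilityMeasure_gibbs lam hV hB
  have hvk := variance_sweep_iterate_le_of_le lam hV hB hθ hcon hg hMg k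
  have hgkm := measurable_sweep_iterate lam hV hg k
  have hgkb := abs_sweep_iterate_le lam hV hB hMg k
  have hmean := integral_sweep_iterate lam hV hB hg hMg k
  set μ := (Measure.pi fun _ : ι => lam).tilted V with hμ
  set gk := (fun g : (ι → E) → ℝ => fun x => (Fintype.card ι : ℝ)⁻¹ *
    ∑ i, ∫ e, g (update x i e) ∂(lam.tilted fun e => V (update x i e)))^[k] g with hgk
  set mg : ℝ := ∫ x, g x ∂μ with hmg
  set mh : ℝ := ∫ x, h x ∂μ with hmh
  -- integrability
  have hgki : Integrable gk μ := HeatBath.integrable_of_abs_le hgkm hgkb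
  have hhi : Integrable h μ := HeatBath.integrable_of_abs_le hh hMh
  have hgkhi : Integrable (fun x => gk x * h x) μ := HeatBath.integrable_mul_of_abs_le μ hgkm hh hgkb hMh
  -- centring: `∫ gk h − mg mh = ∫ (gk − mg)(h − mh)` (the mean of `gk` is `mg`)
  have hcen : ∫ x, gk x * h x ∂μ - mg * mh = ∫ x, (gk x - mg) * (h x - mh) ∂μ := by
    have e : ∀ x, (gk x - mg) * (h x - mh) = (gk x * h x - mh * gk x) - (mg * h x - mg * mh) := fun x => by ring
    simp_rw [e]
    have i1 : Integrable (fun x => gk x * h x - mh * gk x) μ := hgkhi.sub (hgki.const_mul mh)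
    have i2 : Integrable (fun x => mg * h x - mg * mh) μ := (hhi.const_mul mg).sub (integrable_const _)
    rw [integral_sub i1 i2, integral_sub hgkhi (hgki.const_mul mh), integral_sub (hhi.const_mul mg) (integrable_const _),
      integral_const_mul, integral_const_mul, hmean]
    simp only [integral_const, probReal_univ, smul_eq_mul, one_mul]
    ring
  -- Cauchy–Schwarz
  have hub : ∀ x, |gk x - mg| ≤ Mg + |mg| := fun x => (abs_sub _ _).trans (add_le_add (hgkb x) le_rfl)
  have hvb : ∀ x, |h x - mh| ≤ Mh + |mh| := fun x => (abs_sub _ _).trans (add_le_add (hMh x) le_rfl)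
  have hcs := HeatBath.sq_integral_mul_le μ (hgkm.sub measurable_const) (hh.sub measurable_const) hub hvb
  -- the second moments are the variances
  have hvgk : ∫ x, (gk x - mg) ^ 2 ∂μ = variance gk μ := by
    rw [variance_eq_integral hgkm.aemeasurable, hmean]
  have hvh : ∫ x, (h x - mh) ^ 2 ∂μ = variance h μ := by
    rw [variance_eq_integral hh.aemeasurable]
  rw [hcen, ← Real.sqrt_sq_eq_abs]
  apply Real.sqrt_le_sqrt
  calc (∫ x, (gk x - mg) * (h x - mh) ∂μ) ^ 2 ≤ (∫ x, (gk x - mg) ^ 2 ∂μ) * ∫ x, (h x - mh) ^ 2 ∂μ := hcs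
    _ = variance gk μ * variance h μ := by rw [hvgk, hvh]
    _ ≤ θ ^ k * variance g μ * variance h μ := mul_le_mul_of_nonneg_right hvk (variance_nonneg _ _)

/-- ★★★ **WARM-START `L¹` (TOTAL-VARIATION) MIXING**: under a one-step variance contraction `Var_μ(P F) ≤ θ Var_μ(F)`, for every bounded measurable `h`
with `∫ h dμ = 1` (an initial law `h·μ`), `∫ |P^k h − 1| dμ ≤ (θ^k Var_μ(h))^{1/2} = θ^{k/2} ‖h − 1‖_{L²(μ)}` — the density `P^k h` of the `k`-step law
(`integral_sweep_iterate_mul_comm`) converges to `1` in `L¹(μ)`, i.e. the `k`-step law converges to `μ` in total variation, geometrically. [folklore] -/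
theorem integral_abs_sweep_iterate_sub_one_le [Nonempty ι] (hV : Measurable V) {Bv : ℝ} (hB : ∀ x, |V x| ≤ Bv) {θ : ℝ} (hθ : 0 ≤ θ)
    (hcon : ∀ (F : (ι → E) → ℝ), Measurable F → (∃ M : ℝ, ∀ x, |F x| ≤ M) →
      variance (fun x => (Fintype.card ι : ℝ)⁻¹ * ∑ i, ∫ e, F (update x i e) ∂(lam.tilted fun e => V (update x i e)))
        ((Measure.pi fun _ : ι => lam).tilted V) ≤ θ * variance F ((Measure.pi fun _ : ι => lam).tilted V))
    (k : ℕ) {h : (ι → E) → ℝ} (hh : Measurable h) {Mh : ℝ} (hMh : ∀ x, |h x| ≤ Mh)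
    (hmean1 : ∫ x, h x ∂((Measure.pi fun _ : ι => lam).tilted V) = 1) :
    ∫ x, |((fun g : (ι → E) → ℝ => fun x => (Fintype.card ι : ℝ)⁻¹ *
          ∑ i, ∫ e, g (update x i e) ∂(lam.tilted fun e => V (update x i e)))^[k] h) x - 1| ∂((Measure.pi fun _ : ι => lam).tilted V) ≤
      Real.sqrt (θ ^ k * variance h ((Measure.pi fun _ : ι => lam).tilted V)) := by
  haveI := HeatBath.isProbabilityMeasure_gibbs lam hV hB
  have hvk := variance_sweep_iterate_le_of_le lam hV hB hθ hcon hh hMh k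
  have hkm := measurable_sweep_iterate lam hV hh k
  have hkb := abs_sweep_iterate_le lam hV hB hMh k
  have hkmean := integral_sweep_iterate lam hV hB hh hMh k
  set μ := (Measure.pi fun _ : ι => lam).tilted V with hμ
  set hk := (fun g : (ι → E) → ℝ => fun x => (Fintype.card ι : ℝ)⁻¹ *
    ∑ i, ∫ e, g (update x i e) ∂(lam.tilted fun e => V (update x i e)))^[k] h with hhk
  rw [hmean1] at hkmean
  have hum : Measurable fun x => |hk x - 1| := (hkm.sub measurable_const).abs
  have hub : ∀ x, |(|hk x - 1|)| ≤ Mh + 1 := fun x => by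
    rw [abs_abs]
    exact (abs_sub _ _).trans (add_le_add (hkb x) (le_of_eq abs_one))
  have h1b : ∀ _x : ι → E, |(1 : ℝ)| ≤ 1 := fun _ => le_of_eq abs_one
  have hcs := HeatBath.sq_integral_mul_le μ hum measurable_const hub h1b
  have e2 : ∫ x, |hk x - 1| ^ 2 ∂μ = variance hk μ := by
    simp only [sq_abs]
    rw [variance_eq_integral hkm.aemeasurable, hkmean]
  have e3 : ∫ _x : ι → E, (1 : ℝ) ^ 2 ∂μ = 1 := by simp
  have h0 : 0 ≤ ∫ x, |hk x - 1| ∂μ := integral_nonneg fun x => abs_nonneg _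
  rw [← Real.sqrt_sq h0]
  apply Real.sqrt_le_sqrt
  calc (∫ x, |hk x - 1| ∂μ) ^ 2 = (∫ x, |hk x - 1| * 1 ∂μ) ^ 2 := by simp only [mul_one]
    _ ≤ (∫ x, |hk x - 1| ^ 2 ∂μ) * ∫ _x, (1 : ℝ) ^ 2 ∂μ := hcs
    _ = variance hk μ := by rw [e2, e3, mul_one]
    _ ≤ θ ^ k * variance h μ := hvk

/-- ★★ **EVENTS FROM A WARM START**: under a one-step variance contraction `Var_μ(P F) ≤ θ Var_μ(F)`, for every measurable set `S` and every bounded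
measurable `h` with `∫ h dμ = 1`, `|∫ (P^k 1_S) h dμ − μ(S)| ≤ ½ (θ^k Var_μ(h))^{1/2}`: the probability of `S` after `k` random-scan heat-bath updates from
the law `h·μ` is within `½ θ^{k/2} ‖h − 1‖_{L²(μ)}` of `μ(S)` (`Var_μ(1_S) ≤ 1/4`). [folklore] -/
theorem abs_integral_sweep_iterate_indicator_mul_sub_le [Nonempty ι] (hV : Measurable V) {Bv : ℝ} (hB : ∀ x, |V x| ≤ Bv) {θ : ℝ}
    (hθ : 0 ≤ θ)
    (hcon : ∀ (F : (ι → E) → ℝ), Measurable F → (∃ M : ℝ, ∀ x, |F x| ≤ M) →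
      variance (fun x => (Fintype.card ι : ℝ)⁻¹ * ∑ i, ∫ e, F (update x i e) ∂(lam.tilted fun e => V (update x i e)))
        ((Measure.pi fun _ : ι => lam).tilted V) ≤ θ * variance F ((Measure.pi fun _ : ι => lam).tilted V))
    (k : ℕ) {S : Set (ι → E)} (hS : MeasurableSet S) {h : (ι → E) → ℝ} (hh : Measurable h) {Mh : ℝ} (hMh : ∀ x, |h x| ≤ Mh)
    (hmean1 : ∫ x, h x ∂((Measure.pi fun _ : ι => lam).tilted V) = 1) :
    |∫ x, ((fun g : (ι → E) → ℝ => fun x => (Fintype.card ι : ℝ)⁻¹ *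
          ∑ i, ∫ e, g (update x i e) ∂(lam.tilted fun e => V (update x i e)))^[k] (S.indicator 1)) x * h x
          ∂((Measure.pi fun _ : ι => lam).tilted V) - ((Measure.pi fun _ : ι => lam).tilted V).real S| ≤
      Real.sqrt (θ ^ k * variance h ((Measure.pi fun _ : ι => lam).tilted V)) / 2 := by
  haveI := HeatBath.isProbabilityMeasure_gibbs lam hV hB
  have hgm : Measurable (S.indicator (1 : (ι → E) → ℝ)) := measurable_one.indicator hS
  have hgb : ∀ x, |S.indicator (1 : (ι → E) → ℝ) x| ≤ 1 := fun x => by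
    by_cases hx : x ∈ S <;> simp [Set.indicator, hx]
  have main := abs_integral_sweep_iterate_mul_sub_le lam hV hB hθ hcon k hgm hh hgb hMh
  set μ := (Measure.pi fun _ : ι => lam).tilted V with hμ
  have hp : ∫ x, S.indicator (1 : (ι → E) → ℝ) x ∂μ = μ.real S := integral_indicator_one hS
  rw [hp, hmean1, mul_one] at main
  refine main.trans ?_
  -- `Var_μ(1_S) = p(1 − p) ≤ 1/4`
  have hvar : variance (S.indicator (1 : (ι → E) → ℝ)) μ ≤ 1 / 4 := by
    rw [variance_eq_integral hgm.aemeasurable, hp]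
    have e : ∀ x, (S.indicator (1 : (ι → E) → ℝ) x - μ.real S) ^ 2 = (1 - 2 * μ.real S) * S.indicator 1 x + μ.real S ^ 2 := fun x => by
      by_cases hx : x ∈ S
      · simp only [Set.indicator_of_mem hx, Pi.one_apply]; ring
      · simp only [Set.indicator_of_notMem hx]; ring
    simp_rw [e]
    rw [integral_add ((HeatBath.integrable_of_abs_le hgm hgb).const_mul _) (integrable_const _), integral_const_mul, hp]
    simp only [integral_const, probReal_univ, smul_eq_mul, one_mul]
    nlinarith [sq_nonneg (μ.real S - 1 / 2)]
  have hvh : 0 ≤ variance h μ := variance_nonneg _ _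
  have h4 : Real.sqrt 4 = 2 := by
    rw [show (4 : ℝ) = 2 ^ 2 by norm_num]
    exact Real.sqrt_sq (by norm_num)
  calc Real.sqrt (θ ^ k * variance (S.indicator 1) μ * variance h μ) ≤ Real.sqrt (θ ^ k * (1 / 4) * variance h μ) :=
        Real.sqrt_le_sqrt (mul_le_mul_of_nonneg_right (mul_le_mul_of_nonneg_left hvar (pow_nonneg hθ k)) hvh)
    _ = Real.sqrt (θ ^ k * variance h μ) / 2 := by
        rw [show θ ^ k * (1 / 4) * variance h μ = θ ^ k * variance h μ / 4 by ring, Real.sqrt_div' _ (by norm_num : (0 : ℝ) ≤ 4), h4]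

end Abstract

end Summit.Ventures.YMGap.RobustBall.HeatBathSweep

end
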